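import Literature.Analysis.FluidPDE.NSHopfLimit
import HarnessLib

/-!
# Navier–Stokes on `T^d`: energy inequalities, weak continuity and the energy class of the
  limit of a Hopf–Galerkin scheme

Trunk: FluidKinetic. Third part of the proof of the named fact `NS.hopf_galerkin_limit`
(`Literature/Analysis/FluidPDE/NSHopfGalerkin`), continuing `NSHopfLimit`. For a Hopf–Galerkin scheme `(N, F, U)` with `ν > 0` and a field `u` with `L²`
slices to which the approximations converge coefficientwise at every time (the standing
hypotheses `hu`, `hc`, `hum` produced by `IsHopfGalerkinScheme.exists_limitField`), this file
proves the clauses of `Torus.IsLerayHopfOn` that come from lower semicontinuity: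

* **convergence of the forcing work** `∫ₛᵗ ∫ ⟪F n, U n⟫ → ∫ₛᵗ ∫ ⟪f, u⟫` (strong × strong,
  `F n → f` and `U n → u` in `L²ₜₓ`; Robinson–Rodrigo–Sadowski 2016, Thm. 4.4 Step 4;
  Constantin–Foias 1988, Ch. 8, proof of Theorem (Leray), p. 47);
* **the energy inequality of the limit from every time `s` at which `U n s → u s` strongly**
  (`IsHopfGalerkinScheme.energy_ineq_limit_of_tendsto`): partial sums over finitely many
  Fourier modes of `½‖U n t‖²` and of `ν∫ₛᵗ‖∇U n‖²` are bounded by the exact Galerkin energy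
  identity and converge; then the modes are exhausted (monotone convergence) — the Fourier-side
  form of "norms are weakly lower semicontinuous" (RRS Thm. 4.6 / Lemma 4.5 and (4.17)–(4.19);
  CF (8.21); Hopf 1951, §4, (4.6)); hence the energy inequality **from `0` for every `t`**
  (`U n 0 → u₀`, RRS (4.17)) and **from a.e. `s`** along a further subsequence with
  `U n s → u s` for a.e. `s` (RRS Thm. 4.6, Ladyzhenskaya 1969; CF p. 47);
* **weak `L²` continuity in time** of the limit (uniformly small coefficient tails;
  RRS Thm. 4.4 Step 3 with Ex. 4.3, Thm. 3.8; Hopf 1951, §4);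
* the energy class: `u ∈ L^∞(0,T; L²)`, `u t ∈ L²` for all `t`, `u ∈ L²(0,T; H¹)` spectrally
  (`Torus.MemL2Sobolev 0 T 1`; RRS (4.10)–(4.11)).

Theorem-only file.

## Mathlib search

Mathlib (this pin): `MeasureTheory.tendsto_setIntegral_of_L1`,
`intervalIntegral.tendsto_integral_filter_of_dominated_convergence`,
`MeasureTheory.lintegral_tendsto_of_tendsto_of_monotone`, `Filter.extraction_forall_of_eventually'`,
`ENNReal.tendsto_atTop_zero_of_tsum_ne_top`; no Leray–Hopf theory.

## References

* E. Hopf, *Über die Anfangswertaufgabe für die hydrodynamischen Grundgleichungen*, Math. Nachr.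
  4 (1951), 213–231, §4.
* J. C. Robinson, J. L. Rodrigo, W. Sadowski, *The three-dimensional Navier–Stokes equations*
  (CUP 2016), Thm. 3.8, Thm. 4.4 Steps 3–4, (4.10)–(4.11), (4.17)–(4.19), Lemma 4.5, Thm. 4.6,
  Ex. 4.3.
* P. Constantin, C. Foias, *Navier–Stokes Equations* (Chicago 1988), Ch. 8, (8.12)–(8.13),
  (8.21), Theorem (Leray), p. 47.
* O. A. Ladyzhenskaya, *The mathematical theory of viscous incompressible flow*, 2nd ed. (1969)
  (strong energy inequality; cited after RRS 2016, Thm. 4.6).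
-/

noncomputable section

open MeasureTheory TopologicalSpace Set Function Filter Topology UnitAddTorus
open scoped InnerProductSpace RealInnerProductSpace ENNReal NNReal

namespace Literature.Analysis.FluidPDE

/-! ## Generic tools -/

namespace Torus

variable {d : Type*} [Fintype d]

/-- Products of `L²` real fields have integrable inner product. [folklore] -/
theorem integrable_inner_of_memLp {X : Type*} {m : MeasurableSpace X} {μ : Measure X}
    {E : Type*} [NormedAddCommGroup E] [InnerProductSpace ℝ E]
    {v w : X → E} (hv : MemLp v 2 μ) (hw : MemLp w 2 μ) :
    Integrable (fun x => ⟪v x, w x⟫) μ := by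
  refine Integrable.mono' (((hv.integrable_norm_pow two_ne_zero).const_mul 2⁻¹).add
    ((hw.integrable_norm_pow two_ne_zero).const_mul 2⁻¹)) (hv.1.inner hw.1)
    (ae_of_all _ fun x => ?_)
  rw [Real.norm_eq_abs]
  have h1 := FluidPDE.inner_le_young (v x) (w x) one_pos
  have h2 := FluidPDE.inner_le_young (v x) (-(w x)) one_pos
  rw [inner_neg_right, norm_neg] at h2
  have h3 : (2 * (1 : ℝ))⁻¹ = 2⁻¹ := by norm_num
  have h4 : (1 : ℝ) / 2 = 2⁻¹ := by norm_num
  rw [h3, h4] at h1 h2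
  simp only [Pi.add_apply]
  exact abs_le.2 ⟨by linarith, by linarith⟩

/-- **Young's inequality for pairings, extended form**: for a.e. strongly measurable real
fields `v`, `w` on `T^d` and `η > 0`,
`‖∫ ⟪v, w⟫‖ₑ ≤ (2η)⁻¹ ∫⁻ ‖v‖ₑ² + (η/2) ∫⁻ ‖w‖ₑ²` (the left side is the junk value `0` if `⟪v, w⟫`
is not integrable). The only inequality used to pass to limits in products below. [folklore] -/
theorem enorm_integral_inner_le_add {v w : UnitAddTorus d → EuclideanSpace ℝ d}
    (hv : AEStronglyMeasurable v volume) (hw : AEStronglyMeasurable w volume) {η : ℝ}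
    (hη : 0 < η) :
    ‖∫ x, ⟪v x, w x⟫‖ₑ ≤ ENNReal.ofReal (2 * η)⁻¹ * (∫⁻ x, ‖v x‖ₑ ^ 2) +
      ENNReal.ofReal (η / 2) * ∫⁻ x, ‖w x‖ₑ ^ 2 := by
  calc ‖∫ x, ⟪v x, w x⟫‖ₑ ≤ ∫⁻ x, ‖⟪v x, w x⟫‖ₑ := enorm_integral_le_lintegral_enorm _
    _ ≤ ∫⁻ x, (ENNReal.ofReal (2 * η)⁻¹ * ‖v x‖ₑ ^ 2 + ENNReal.ofReal (η / 2) * ‖w x‖ₑ ^ 2) := by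
        refine lintegral_mono fun x => ?_
        have h1 := FluidPDE.inner_le_young (v x) (w x) hη
        have h2 := FluidPDE.inner_le_young (v x) (-(w x)) hη
        rw [inner_neg_right, norm_neg] at h2
        have habs : |⟪v x, w x⟫| ≤ (2 * η)⁻¹ * ‖v x‖ ^ 2 + η / 2 * ‖w x‖ ^ 2 :=
          abs_le.2 ⟨by linarith, h1⟩
        rw [Real.enorm_eq_ofReal_abs]
        refine (ENNReal.ofReal_le_ofReal habs).trans_eq ?_
        rw [ENNReal.ofReal_add (by positivity) (by positivity), ENNReal.ofReal_mul (by positivity),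
          ENNReal.ofReal_mul (by positivity), ← ofReal_norm, ← ofReal_norm,
          ENNReal.ofReal_pow (norm_nonneg _), ENNReal.ofReal_pow (norm_nonneg _)]
    _ = _ := by
        rw [lintegral_add_left' ((hv.enorm.pow_const 2).const_mul _),
          lintegral_const_mul'' _ (hv.enorm.pow_const 2), lintegral_const_mul'' _ (hw.enorm.pow_const 2)]

/-- `∫⁻ ‖v‖ₑ² = ofReal (∫ ‖v‖²)` for `v ∈ L²`. [folklore] -/
theorem lintegral_enorm_sq_eq_ofReal {X : Type*} {m : MeasurableSpace X} {μ : Measure X}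
    {E : Type*} [NormedAddCommGroup E] {v : X → E} (hv : MemLp v 2 μ) :
    ∫⁻ x, ‖v x‖ₑ ^ 2 ∂μ = ENNReal.ofReal (∫ x, ‖v x‖ ^ 2 ∂μ) := by
  rw [ofReal_integral_eq_lintegral_ofReal (hv.integrable_norm_pow two_ne_zero)
    (ae_of_all _ fun x => by positivity)]
  refine lintegral_congr fun x => ?_
  rw [← ofReal_norm, ENNReal.ofReal_pow (norm_nonneg _)]

/-- An interval integral of a continuous nonnegative function as a Lebesgue integral over the
open interval: `∫ₛᵗ b = (∫⁻_{(s,t)} ofReal ∘ b).toReal` for `s ≤ t`. [folklore] -/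
theorem intervalIntegral_eq_toReal_lintegral {b : ℝ → ℝ} {s t : ℝ} (hst : s ≤ t)
    (hb : ContinuousOn b (Icc s t)) (hnn : ∀ τ ∈ Icc s t, 0 ≤ b τ) :
    ∫ τ in s..t, b τ = (∫⁻ τ in Ioo s t, ENNReal.ofReal (b τ)).toReal := by
  rw [intervalIntegral.integral_of_le hst, integral_Ioc_eq_integral_Ioo,
    integral_eq_lintegral_of_nonneg_ae]
  · exact (ae_restrict_mem measurableSet_Ioo).mono fun τ hτ => hnn τ (Ioo_subset_Icc_self hτ)
  · exact (hb.mono Ioo_subset_Icc_self).aestronglyMeasurable measurableSet_Ioo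

/-- `‖v‖_{L²} = (∫⁻ ‖v‖ₑ²)^{1/2}`. [folklore] -/
theorem eLpNorm_two_eq_rpow {X : Type*} {m : MeasurableSpace X} {μ : Measure X} {E : Type*}
    [NormedAddCommGroup E] (v : X → E) :
    eLpNorm v 2 μ = (∫⁻ x, ‖v x‖ₑ ^ 2 ∂μ) ^ (1 / 2 : ℝ) := by
  rw [eLpNorm_eq_lintegral_rpow_enorm_toReal two_ne_zero ENNReal.ofNat_ne_top, ENNReal.toReal_ofNat]
  congr 1
  refine lintegral_congr fun x => ?_
  rw [ENNReal.rpow_two]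

/-- **Strong `L²` convergence implies convergence of the squared norms**:
`‖vᵢ - w‖_{L²} → 0` implies `∫ ‖vᵢ‖² → ∫ ‖w‖²` (continuity of the norm in the Hilbert space
`L²`; Robinson–Rodrigo–Sadowski 2016, Lemma A.20, trivial direction). [folklore] -/
theorem tendsto_integral_norm_sq_of_tendsto_eLpNorm_sub {X E ι : Type*} {m : MeasurableSpace X}
    {μ : Measure X} [NormedAddCommGroup E] [InnerProductSpace ℝ E] {l : Filter ι}
    {v : ι → X → E} {w : X → E} (hv : ∀ i, MemLp (v i) 2 μ) (hw : MemLp w 2 μ)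
    (h : Tendsto (fun i => eLpNorm (v i - w) 2 μ) l (𝓝 0)) :
    Tendsto (fun i => ∫ x, ‖v i x‖ ^ 2 ∂μ) l (𝓝 (∫ x, ‖w x‖ ^ 2 ∂μ)) := by
  set a : ι → Lp E 2 μ := fun i => (hv i).toLp (v i) with ha
  set b : Lp E 2 μ := hw.toLp w with hb
  have hnormsq : ∀ {g : X → E} (hg : MemLp g 2 μ), ‖hg.toLp g‖ ^ 2 = ∫ x, ‖g x‖ ^ 2 ∂μ := by
    intro g hg
    rw [← real_inner_self_eq_norm_sq, MeasureTheory.L2.inner_def]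
    refine integral_congr_ae ?_
    filter_upwards [hg.coeFn_toLp] with x hx
    rw [hx, real_inner_self_eq_norm_sq]
  have hdist : Tendsto (fun i => ‖a i - b‖) l (𝓝 0) := by
    have heq : ∀ i, ‖a i - b‖ = (eLpNorm (v i - w) 2 μ).toReal := fun i => by
      rw [ha, hb, ← MemLp.toLp_sub (hv i) hw, Lp.norm_toLp]
    simp_rw [heq]
    have h' := (ENNReal.tendsto_toReal ENNReal.zero_ne_top).comp h
    simpa [Function.comp_def] using h'
  have hab : Tendsto a l (𝓝 b) := tendsto_iff_norm_sub_tendsto_zero.2 hdist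
  have h2 := (hab.norm).pow 2
  simp_rw [ha, hnormsq (hv _)] at h2
  rw [hb, hnormsq hw] at h2
  exact h2

/-- **An `ε/2`-lemma in `ℝ≥0∞`**: if `a n ≤ λ·C + X_λ(n)` for every `λ > 0`, with `C` finite and
`X_λ(n) → 0` for each `λ`, then `a n → 0`. Packages the "choose `λ` small, then `n` large"
arguments of this file. [folklore] -/
theorem _root_.ENNReal.tendsto_zero_of_forall_le_ofReal_mul_add {a : ℕ → ℝ≥0∞} {C : ℝ≥0∞}
    (hC : C ≠ ⊤) {X : ℝ → ℕ → ℝ≥0∞} (hX : ∀ lam : ℝ, 0 < lam → Tendsto (X lam) atTop (𝓝 0))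
    (h : ∀ lam : ℝ, 0 < lam → ∀ᶠ n in atTop, a n ≤ ENNReal.ofReal lam * C + X lam n) :
    Tendsto a atTop (𝓝 0) := by
  rw [ENNReal.tendsto_nhds_zero]
  intro ε hε
  obtain ⟨δ, hδ, hδε⟩ : ∃ δ : ℝ, 0 < δ ∧ ENNReal.ofReal δ ≤ ε := by
    rcases eq_or_ne ε ⊤ with h | h
    · exact ⟨1, one_pos, h ▸ le_top⟩
    · exact ⟨ε.toReal, ENNReal.toReal_pos hε.ne' h, (ENNReal.ofReal_toReal h).le⟩
  set lam : ℝ := δ / 2 / (C.toReal + 1) with hlam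
  have hC0 : 0 ≤ C.toReal := ENNReal.toReal_nonneg
  have hlam0 : 0 < lam := by positivity
  have h1 : ENNReal.ofReal lam * C ≤ ENNReal.ofReal (δ / 2) := by
    rw [← ENNReal.ofReal_toReal hC, ← ENNReal.ofReal_mul hlam0.le]
    refine ENNReal.ofReal_le_ofReal ?_
    rw [hlam, div_mul_eq_mul_div, div_le_iff₀ (by positivity)]
    nlinarith
  have h2 := ENNReal.tendsto_nhds_zero.1 (hX lam hlam0) (ENNReal.ofReal (δ / 2))
    (ENNReal.ofReal_pos.2 (by positivity))
  filter_upwards [h lam hlam0, h2] with n hn hXn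
  calc a n ≤ ENNReal.ofReal lam * C + X lam n := hn
    _ ≤ ENNReal.ofReal (δ / 2) + ENNReal.ofReal (δ / 2) := add_le_add h1 hXn
    _ = ENNReal.ofReal δ := by rw [← ENNReal.ofReal_add (by positivity) (by positivity), add_halves]
    _ ≤ ε := hδε

end Torus

section NS

variable {d : Type*} [Fintype d] [DecidableEq d]

variable {ν : ℝ} {f : ℝ → UnitAddTorus d → EuclideanSpace ℝ d}
  {u₀ : UnitAddTorus d → EuclideanSpace ℝ d} {N : ℕ → ℕ}
  {F U : ℕ → ℝ → UnitAddTorus d → EuclideanSpace ℝ d}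
  {u : ℝ → UnitAddTorus d → EuclideanSpace ℝ d}

/-! ## Measurability bookkeeping for the scheme -/

section Measurability

/-- The approximate forces are a.e. strongly measurable on `(0, ∞) × ℝ^d` (continuous). [folklore] -/
theorem IsHopfGalerkinScheme.aestronglyMeasurable_stLift_force
    (hS : IsHopfGalerkinScheme ν f u₀ N F U) (n : ℕ) :
    AEStronglyMeasurable (FunctionSpaces.Torus.stLift (F n)) (volume.restrict (Ioi 0 ×ˢ univ)) :=
  (hS.smooth_force n).continuous.aestronglyMeasurable

/-- The approximations are a.e. strongly measurable on `(0, ∞) × ℝ^d` (continuous on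
`[0, ∞) × ℝ^d`). [folklore] -/
theorem IsHopfGalerkinScheme.aestronglyMeasurable_stLift (hS : IsHopfGalerkinScheme ν f u₀ N F U)
    (n : ℕ) : AEStronglyMeasurable (FunctionSpaces.Torus.stLift (U n)) (volume.restrict (Ioi 0 ×ˢ univ)) :=
  ((hS.continuousOn n).aestronglyMeasurable (measurableSet_Ici.prod MeasurableSet.univ)).mono_measure
    (Measure.restrict_mono (prod_mono Ioi_subset_Ici_self subset_rfl) le_rfl)

omit [DecidableEq d] in
/-- Measurability in time of `∫⁻ ‖v t - w t‖ₑ²` for two space–time measurable fields. [folklore] -/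
theorem Torus.aemeasurable_lintegral_enorm_sub_sq
    {v w : ℝ → UnitAddTorus d → EuclideanSpace ℝ d}
    (hv : AEStronglyMeasurable (FunctionSpaces.Torus.stLift v) (volume.restrict (Ioi 0 ×ˢ univ)))
    (hw : AEStronglyMeasurable (FunctionSpaces.Torus.stLift w) (volume.restrict (Ioi 0 ×ˢ univ))) (T : ℝ) :
    AEMeasurable (fun t => ∫⁻ x, ‖v t x - w t x‖ₑ ^ 2) (volume.restrict (Ioo 0 T)) :=
  (((FunctionSpaces.Torus.aestronglyMeasurable_uncurry_prod_of_stLift hv T).sub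
    (FunctionSpaces.Torus.aestronglyMeasurable_uncurry_prod_of_stLift hw T)).enorm.pow_const 2).lintegral_prod_right'

omit [DecidableEq d] in
/-- Measurability in time of `∫⁻ ‖v t‖ₑ²` for a space–time measurable field. [folklore] -/
theorem Torus.aemeasurable_lintegral_enorm_sq
    {v : ℝ → UnitAddTorus d → EuclideanSpace ℝ d}
    (hv : AEStronglyMeasurable (FunctionSpaces.Torus.stLift v) (volume.restrict (Ioi 0 ×ˢ univ))) (T : ℝ) :
    AEMeasurable (fun t => ∫⁻ x, ‖v t x‖ₑ ^ 2) (volume.restrict (Ioo 0 T)) :=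
  ((FunctionSpaces.Torus.aestronglyMeasurable_uncurry_prod_of_stLift hv T).enorm.pow_const 2).lintegral_prod_right'

omit [DecidableEq d] in
/-- Measurability in time of a pairing `t ↦ ∫ ⟪v t, w t⟫` of two space–time measurable
fields. [folklore] -/
theorem Torus.aestronglyMeasurable_integral_inner
    {v w : ℝ → UnitAddTorus d → EuclideanSpace ℝ d}
    (hv : AEStronglyMeasurable (FunctionSpaces.Torus.stLift v) (volume.restrict (Ioi 0 ×ˢ univ)))
    (hw : AEStronglyMeasurable (FunctionSpaces.Torus.stLift w) (volume.restrict (Ioi 0 ×ˢ univ))) (T : ℝ) :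
    AEStronglyMeasurable (fun t => ∫ x, ⟪v t x, w t x⟫) (volume.restrict (Ioo 0 T)) := by
  have h : AEStronglyMeasurable (fun p : ℝ × UnitAddTorus d => ⟪uncurry v p, uncurry w p⟫)
      ((volume.restrict (Ioo 0 T)).prod volume) :=
    (FunctionSpaces.Torus.aestronglyMeasurable_uncurry_prod_of_stLift hv T).inner
      (FunctionSpaces.Torus.aestronglyMeasurable_uncurry_prod_of_stLift hw T)
  exact h.integral_prod_right'

end Measurability

/-! ## Convergence of the forcing work -/

section Work

/-- **The forcing work converges in `L¹(0, T)`** (Robinson–Rodrigo–Sadowski 2016, Thm. 4.4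
Step 4; Constantin–Foias 1988, p. 47): `∫₀ᵀ |∫⟪F n, U n⟫ - ∫⟪f, u⟫| dt → 0`, because
`∫⟪F n, U n⟫ - ∫⟪f, u⟫ = ∫⟪F n - f, U n⟫ + ∫⟪U n - u, f⟫` with `F n → f`, `U n → u` in
`L²ₜₓ` (the latter by `tendsto_lintegral_enorm_sub_sq`) and `U n`, `f` bounded in `L²ₜₓ`
(Young's inequality with a free parameter). [cite: RobinsonRodrigoSadowski2016, Thm. 4.4 Step 4] -/
theorem IsHopfGalerkinScheme.tendsto_lintegral_work_sub (hS : IsHopfGalerkinScheme ν f u₀ N F U)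
    (hν : 0 < ν) (hu₀ : MemLp u₀ 2 volume)
    (hfm : AEStronglyMeasurable (FunctionSpaces.Torus.stLift f) (volume.restrict (Ioi 0 ×ˢ univ)))
    (hf₂ : ∀ T, 0 < T → ∫⁻ t in Ioo 0 T, ∫⁻ x, ‖f t x‖ₑ ^ 2 < ⊤)
    (hum : AEStronglyMeasurable (FunctionSpaces.Torus.stLift u) (volume.restrict (Ioi 0 ×ˢ univ)))
    (hu : ∀ t, 0 ≤ t → MemLp (u t) 2 volume)
    (hc : ∀ t, 0 ≤ t → ∀ k, Tendsto (fun n => mFourierCoeff (FunctionSpaces.EuclideanSpace.complexify ∘ U n t) k)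
      atTop (𝓝 (mFourierCoeff (FunctionSpaces.EuclideanSpace.complexify ∘ u t) k))) {T : ℝ} (hT : 0 < T) :
    Tendsto (fun n => ∫⁻ τ in Ioo 0 T,
      ‖(∫ x, ⟪F n τ x, U n τ x⟫) - ∫ x, ⟪f τ x, u τ x⟫‖ₑ) atTop (𝓝 0) := by
  obtain ⟨A, hA, hFA⟩ := hS.exists_force_bound hfm hf₂ hT
  obtain ⟨Y, hYdef⟩ : ∃ Y : ℝ, Y = 2 * (∫ x, ‖u₀ x‖ ^ 2) + 4 * T * A.toReal := ⟨_, rfl⟩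
  have hYn : ∀ n, ∀ t ∈ Icc 0 T, ∫ x, ‖U n t x‖ ^ 2 ≤ Y := fun n t ht =>
    (hS.integral_norm_sq_le hν.le hT hA n (hFA n) ht).trans (by
      have := hS.integral_norm_sq_zero_le hu₀ n
      rw [hYdef]; linarith)
  have hY0 : 0 ≤ Y := le_trans (integral_nonneg fun x => sq_nonneg _) (hYn 0 0 ⟨le_rfl, hT.le⟩)
  -- the four space–time quantities
  have hX : Tendsto (fun n => ∫⁻ τ in Ioo 0 T, ∫⁻ x, ‖F n τ x - f τ x‖ₑ ^ 2) atTop (𝓝 0) :=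
    hS.tendsto_force T hT
  have hZ : Tendsto (fun n => ∫⁻ τ in Ioo 0 T, ∫⁻ x, ‖U n τ x - u τ x‖ₑ ^ 2) atTop (𝓝 0) :=
    hS.tendsto_lintegral_enorm_sub_sq hν hu₀ hfm hf₂ hum hu hc hT
  have hB : ∀ n, ∫⁻ τ in Ioo 0 T, ∫⁻ x, ‖U n τ x‖ₑ ^ 2 ≤ ENNReal.ofReal (T * Y) := by
    intro n
    calc ∫⁻ τ in Ioo 0 T, ∫⁻ x, ‖U n τ x‖ₑ ^ 2 ≤ ∫⁻ _ in Ioo 0 T, ENNReal.ofReal Y := by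
          refine setLIntegral_mono' measurableSet_Ioo fun τ hτ => ?_
          rw [← ofReal_integral_norm_sq_slice (hS.continuousOn n) hτ.1.le]
          exact ENNReal.ofReal_le_ofReal (hYn n τ ⟨hτ.1.le, hτ.2.le⟩)
      _ = ENNReal.ofReal (T * Y) := by
          rw [setLIntegral_const, Real.volume_Ioo, sub_zero, ← ENNReal.ofReal_mul hY0, mul_comm]
  set Φ : ℝ≥0∞ := ∫⁻ τ in Ioo 0 T, ∫⁻ x, ‖f τ x‖ₑ ^ 2 with hΦ
  have hΦfin : Φ < ⊤ := hf₂ T hT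
  -- pointwise (a.e. in `τ`) bound for every `λ > 0`
  have hpt : ∀ {lam : ℝ}, 0 < lam → ∀ n, ∀ᵐ τ ∂(volume.restrict (Ioo 0 T)),
      ‖(∫ x, ⟪F n τ x, U n τ x⟫) - ∫ x, ⟪f τ x, u τ x⟫‖ₑ ≤
        ENNReal.ofReal (2 * lam)⁻¹ * (∫⁻ x, ‖F n τ x - f τ x‖ₑ ^ 2) +
          ENNReal.ofReal (lam / 2) * (∫⁻ x, ‖U n τ x‖ₑ ^ 2) +
          (ENNReal.ofReal (2 * lam)⁻¹ * (∫⁻ x, ‖U n τ x - u τ x‖ₑ ^ 2) +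
            ENNReal.ofReal (lam / 2) * ∫⁻ x, ‖f τ x‖ₑ ^ 2) := by
    intro lam hlam n
    filter_upwards [FunctionSpaces.Torus.ae_memLp_slice hfm (hf₂ T hT), ae_restrict_mem measurableSet_Ioo]
      with τ hfτ hτ
    have hτ0 : 0 ≤ τ := hτ.1.le
    have hUm : MemLp (U n τ) 2 volume := hS.memLp_slice n hτ0
    have hFm : MemLp (F n τ) 2 volume := (hS.continuous_force_slice n hτ0).memLp_of_hasCompactSupport
      (HasCompactSupport.of_compactSpace _)
    have hum' : MemLp (u τ) 2 volume := hu τ hτ0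
    have i1 : Integrable (fun x => ⟪F n τ x, U n τ x⟫) volume :=
      Torus.integrable_inner_of_memLp hFm hUm
    have i2 : Integrable (fun x => ⟪f τ x, u τ x⟫) volume := Torus.integrable_inner_of_memLp hfτ hum'
    have i3 : Integrable (fun x => ⟪F n τ x - f τ x, U n τ x⟫) volume :=
      Torus.integrable_inner_of_memLp (hFm.sub hfτ) hUm
    have i4 : Integrable (fun x => ⟪U n τ x - u τ x, f τ x⟫) volume :=
      Torus.integrable_inner_of_memLp (hUm.sub hum') hfτ
    have hdiff : (∫ x, ⟪F n τ x, U n τ x⟫) - ∫ x, ⟪f τ x, u τ x⟫ =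
        (∫ x, ⟪F n τ x - f τ x, U n τ x⟫) + ∫ x, ⟪U n τ x - u τ x, f τ x⟫ := by
      rw [← integral_sub i1 i2, ← integral_add i3 i4]
      refine integral_congr_ae (ae_of_all _ fun x => ?_)
      simp only [inner_sub_left, inner_sub_right, real_inner_comm (f τ x)]
      ring
    rw [hdiff]
    have ha1 : AEStronglyMeasurable (fun x => F n τ x - f τ x) volume := (hFm.sub hfτ).1
    have ha2 : AEStronglyMeasurable (fun x => U n τ x - u τ x) volume := (hUm.sub hum').1
    refine (enorm_add_le _ _).trans (add_le_add ?_ ?_)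
    · exact Torus.enorm_integral_inner_le_add ha1 hUm.1 hlam
    · exact Torus.enorm_integral_inner_le_add ha2 hfτ.1 hlam
  -- measurability in `τ` of the four bounds
  have hm1 : ∀ n, AEMeasurable (fun τ => ∫⁻ x, ‖F n τ x - f τ x‖ₑ ^ 2) (volume.restrict (Ioo 0 T)) :=
    fun n => Torus.aemeasurable_lintegral_enorm_sub_sq (hS.aestronglyMeasurable_stLift_force n) hfm T
  have hm2 : ∀ n, AEMeasurable (fun τ => ∫⁻ x, ‖U n τ x‖ₑ ^ 2) (volume.restrict (Ioo 0 T)) :=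
    fun n => Torus.aemeasurable_lintegral_enorm_sq (hS.aestronglyMeasurable_stLift n) T
  have hm3 : ∀ n, AEMeasurable (fun τ => ∫⁻ x, ‖U n τ x - u τ x‖ₑ ^ 2) (volume.restrict (Ioo 0 T)) :=
    fun n => Torus.aemeasurable_lintegral_enorm_sub_sq (hS.aestronglyMeasurable_stLift n) hum T
  have hm4 : AEMeasurable (fun τ => ∫⁻ x, ‖f τ x‖ₑ ^ 2) (volume.restrict (Ioo 0 T)) :=
    Torus.aemeasurable_lintegral_enorm_sq hfm T
  -- integrate
  have hint : ∀ {lam : ℝ}, 0 < lam → ∀ n,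
      ∫⁻ τ in Ioo 0 T, ‖(∫ x, ⟪F n τ x, U n τ x⟫) - ∫ x, ⟪f τ x, u τ x⟫‖ₑ ≤
        ENNReal.ofReal (lam / 2) * (ENNReal.ofReal (T * Y) + Φ) +
          ENNReal.ofReal (2 * lam)⁻¹ * ((∫⁻ τ in Ioo 0 T, ∫⁻ x, ‖F n τ x - f τ x‖ₑ ^ 2) +
            ∫⁻ τ in Ioo 0 T, ∫⁻ x, ‖U n τ x - u τ x‖ₑ ^ 2) := by
    intro lam hlam n
    calc ∫⁻ τ in Ioo 0 T, ‖(∫ x, ⟪F n τ x, U n τ x⟫) - ∫ x, ⟪f τ x, u τ x⟫‖ₑ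
        ≤ ∫⁻ τ in Ioo 0 T, (ENNReal.ofReal (2 * lam)⁻¹ * (∫⁻ x, ‖F n τ x - f τ x‖ₑ ^ 2) +
            ENNReal.ofReal (lam / 2) * (∫⁻ x, ‖U n τ x‖ₑ ^ 2) +
            (ENNReal.ofReal (2 * lam)⁻¹ * (∫⁻ x, ‖U n τ x - u τ x‖ₑ ^ 2) +
              ENNReal.ofReal (lam / 2) * ∫⁻ x, ‖f τ x‖ₑ ^ 2)) := lintegral_mono_ae (hpt hlam n)
      _ = ENNReal.ofReal (2 * lam)⁻¹ * (∫⁻ τ in Ioo 0 T, ∫⁻ x, ‖F n τ x - f τ x‖ₑ ^ 2) +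
            ENNReal.ofReal (lam / 2) * (∫⁻ τ in Ioo 0 T, ∫⁻ x, ‖U n τ x‖ₑ ^ 2) +
            (ENNReal.ofReal (2 * lam)⁻¹ * (∫⁻ τ in Ioo 0 T, ∫⁻ x, ‖U n τ x - u τ x‖ₑ ^ 2) +
              ENNReal.ofReal (lam / 2) * Φ) := by
          have hA' : AEMeasurable (fun τ => ENNReal.ofReal (2 * lam)⁻¹ *
              (∫⁻ x, ‖F n τ x - f τ x‖ₑ ^ 2) + ENNReal.ofReal (lam / 2) * (∫⁻ x, ‖U n τ x‖ₑ ^ 2))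
              (volume.restrict (Ioo 0 T)) := ((hm1 n).const_mul _).add ((hm2 n).const_mul _)
          rw [lintegral_add_left' hA',
            lintegral_add_left' ((hm1 n).const_mul _), lintegral_add_left' ((hm3 n).const_mul _),
            lintegral_const_mul'' _ (hm1 n), lintegral_const_mul'' _ (hm2 n),
            lintegral_const_mul'' _ (hm3 n), lintegral_const_mul'' _ hm4]
      _ ≤ ENNReal.ofReal (2 * lam)⁻¹ * (∫⁻ τ in Ioo 0 T, ∫⁻ x, ‖F n τ x - f τ x‖ₑ ^ 2) +
            ENNReal.ofReal (lam / 2) * ENNReal.ofReal (T * Y) +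
            (ENNReal.ofReal (2 * lam)⁻¹ * (∫⁻ τ in Ioo 0 T, ∫⁻ x, ‖U n τ x - u τ x‖ₑ ^ 2) +
              ENNReal.ofReal (lam / 2) * Φ) := by
          gcongr
          exact hB n
      _ = _ := by ring
  -- conclude
  refine ENNReal.tendsto_zero_of_forall_le_ofReal_mul_add (C := ENNReal.ofReal (T * Y) + Φ)
    (ENNReal.add_ne_top.2 ⟨ENNReal.ofReal_ne_top, hΦfin.ne⟩)
    (X := fun lam n => ENNReal.ofReal (2 * (2 * lam))⁻¹ *
      ((∫⁻ τ in Ioo 0 T, ∫⁻ x, ‖F n τ x - f τ x‖ₑ ^ 2) +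
        ∫⁻ τ in Ioo 0 T, ∫⁻ x, ‖U n τ x - u τ x‖ₑ ^ 2)) (fun lam hlam => ?_) (fun lam hlam => ?_)
  · have h := ENNReal.Tendsto.const_mul (hX.add hZ) (a := ENNReal.ofReal (2 * (2 * lam))⁻¹)
      (Or.inr ENNReal.ofReal_ne_top)
    simpa using h
  · refine Eventually.of_forall fun n => ?_
    have h := hint (lam := 2 * lam) (by positivity) n
    rwa [show 2 * lam / 2 = lam by ring] at h

/-- **The forcing work is integrable in time**: `τ ↦ ∫ ⟪f τ, u τ⟫` is integrable on `(0, T)`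
(`|∫⟪f, u⟫| ≤ ½∫‖f‖² + ½∫‖u‖²`, with `f ∈ L²ₜₓ` and `u ∈ L^∞ₜL²ₓ`), so that the time integrals
in the energy inequality of the limit are genuine. [folklore] -/
theorem IsHopfGalerkinScheme.integrableOn_work_limit (hS : IsHopfGalerkinScheme ν f u₀ N F U)
    (hν : 0 < ν) (hu₀ : MemLp u₀ 2 volume)
    (hfm : AEStronglyMeasurable (FunctionSpaces.Torus.stLift f) (volume.restrict (Ioi 0 ×ˢ univ)))
    (hf₂ : ∀ T, 0 < T → ∫⁻ t in Ioo 0 T, ∫⁻ x, ‖f t x‖ₑ ^ 2 < ⊤)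
    (hum : AEStronglyMeasurable (FunctionSpaces.Torus.stLift u) (volume.restrict (Ioi 0 ×ˢ univ)))
    (hu : ∀ t, 0 ≤ t → MemLp (u t) 2 volume)
    (hc : ∀ t, 0 ≤ t → ∀ k, Tendsto (fun n => mFourierCoeff (FunctionSpaces.EuclideanSpace.complexify ∘ U n t) k)
      atTop (𝓝 (mFourierCoeff (FunctionSpaces.EuclideanSpace.complexify ∘ u t) k))) {T : ℝ} (hT : 0 < T) :
    IntegrableOn (fun τ => ∫ x, ⟪f τ x, u τ x⟫) (Ioo 0 T) volume := by
  obtain ⟨A, hA, hFA⟩ := hS.exists_force_bound hfm hf₂ hT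
  obtain ⟨Y, hYdef⟩ : ∃ Y : ℝ, Y = 2 * (∫ x, ‖u₀ x‖ ^ 2) + 4 * T * A.toReal := ⟨_, rfl⟩
  have hYu : ∀ t ∈ Icc 0 T, ∫ x, ‖u t x‖ ^ 2 ≤ Y := fun t ht => by
    rw [hYdef]; exact hS.integral_norm_sq_limit_le hν.le hu₀ hu hc hT hA hFA ht
  refine ⟨Torus.aestronglyMeasurable_integral_inner hfm hum T, ?_⟩
  -- finite integral
  have hpt : ∀ᵐ τ ∂(volume.restrict (Ioo 0 T)), ‖∫ x, ⟪f τ x, u τ x⟫‖ₑ ≤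
      ENNReal.ofReal (2 * 1)⁻¹ * (∫⁻ x, ‖f τ x‖ₑ ^ 2) + ENNReal.ofReal (1 / 2) * ENNReal.ofReal Y := by
    filter_upwards [FunctionSpaces.Torus.ae_memLp_slice hfm (hf₂ T hT), ae_restrict_mem measurableSet_Ioo]
      with τ hfτ hτ
    have hτ' : τ ∈ Icc 0 T := ⟨hτ.1.le, hτ.2.le⟩
    refine (Torus.enorm_integral_inner_le_add hfτ.1 (hu τ hτ.1.le).1 one_pos).trans ?_
    gcongr
    rw [Torus.lintegral_enorm_sq_eq_ofReal (hu τ hτ.1.le)]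
    exact ENNReal.ofReal_le_ofReal (hYu τ hτ')
  refine lt_of_le_of_lt (lintegral_mono_ae hpt) ?_
  rw [lintegral_add_left' ((Torus.aemeasurable_lintegral_enorm_sq hfm T).const_mul _),
    lintegral_const_mul'' _ (Torus.aemeasurable_lintegral_enorm_sq hfm T), setLIntegral_const]
  refine ENNReal.add_lt_top.2 ⟨ENNReal.mul_lt_top ENNReal.ofReal_lt_top (hf₂ T hT), ?_⟩
  exact ENNReal.mul_lt_top (ENNReal.mul_lt_top ENNReal.ofReal_lt_top ENNReal.ofReal_lt_top)
    measure_Ioo_lt_top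

end Work

/-! ## The energy inequality of the limit -/

section EnergyIneq

omit [DecidableEq d] in
/-- Partial Parseval sums are bounded by the energy: `∑_{k∈S} ‖v̂ k‖² ≤ ∫ ‖v‖²` (`v ∈ L²`). [folklore] -/
theorem Torus.sum_norm_sq_mFourierCoeff_le_integral
    {v : UnitAddTorus d → EuclideanSpace ℝ d} (hv : MemLp v 2 volume) (S : Finset (d → ℤ)) :
    ∑ k ∈ S, ‖mFourierCoeff (FunctionSpaces.EuclideanSpace.complexify ∘ v) k‖ ^ 2 ≤ ∫ x, ‖v x‖ ^ 2 :=
  sum_le_hasSum S (fun _ _ => sq_nonneg _) (FunctionSpaces.Torus.hasSum_sq_norm_mFourierCoeff_complexify hv)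

omit [DecidableEq d] in
/-- Partial spectral dissipation sums in `ℝ≥0∞`:
`ofReal (4π² ∑_{k∈S} |k|² ‖a k‖²) = ∑_{k∈S} ofReal(4π²) (ofReal |k|² ‖a k‖ₑ²)`. [folklore] -/
theorem Torus.ofReal_dissipation_sum_eq (a : (d → ℤ) → EuclideanSpace ℂ d)
    (S : Finset (d → ℤ)) :
    ENNReal.ofReal (4 * Real.pi ^ 2 * ∑ k ∈ S, FunctionSpaces.Torus.freqNormSq k * ‖a k‖ ^ 2) =
      ∑ k ∈ S, ENNReal.ofReal (4 * Real.pi ^ 2) * (ENNReal.ofReal (FunctionSpaces.Torus.freqNormSq k) * ‖a k‖ₑ ^ 2) := by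
  rw [ENNReal.ofReal_mul (by positivity), ENNReal.ofReal_sum_of_nonneg fun k _ =>
    mul_nonneg (FunctionSpaces.Torus.freqNormSq_nonneg k) (sq_nonneg _), Finset.mul_sum]
  refine Finset.sum_congr rfl fun k _ => ?_
  rw [ENNReal.ofReal_mul (FunctionSpaces.Torus.freqNormSq_nonneg k), ← ofReal_norm, ENNReal.ofReal_pow (norm_nonneg _)]

omit [DecidableEq d] in
/-- Partial spectral dissipation sums are bounded by the spectral gradient norm:
`ofReal (4π² ∑_{k∈S} |k|² ‖v̂ k‖²) ≤ ‖∇v‖²` (`eGradNormSq`). [folklore] -/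
theorem Torus.ofReal_dissipation_sum_le_eGradNormSq (v : UnitAddTorus d → EuclideanSpace ℝ d)
    (S : Finset (d → ℤ)) :
    ENNReal.ofReal (4 * Real.pi ^ 2 * ∑ k ∈ S, FunctionSpaces.Torus.freqNormSq k *
        ‖mFourierCoeff (FunctionSpaces.EuclideanSpace.complexify ∘ v) k‖ ^ 2) ≤ FunctionSpaces.Torus.eGradNormSq v := by
  rw [Torus.ofReal_dissipation_sum_eq, FunctionSpaces.Torus.eGradNormSq_eq_tsum, ← ENNReal.tsum_mul_left]
  exact ENNReal.sum_le_tsum S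

/-- The partial dissipation integrands of the Galerkin approximations are continuous on
`[0, ∞)`. [folklore] -/
theorem IsHopfGalerkinScheme.continuousOn_dissipation_sum (hS : IsHopfGalerkinScheme ν f u₀ N F U)
    (n : ℕ) (S : Finset (d → ℤ)) :
    ContinuousOn (fun τ => 4 * Real.pi ^ 2 * ∑ k ∈ S, FunctionSpaces.Torus.freqNormSq k *
      ‖mFourierCoeff (FunctionSpaces.EuclideanSpace.complexify ∘ U n τ) k‖ ^ 2) (Ici 0) :=
  continuousOn_const.mul (continuousOn_finsetSum _ fun k _ => continuousOn_const.mul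
    ((FunctionSpaces.Torus.continuousOn_mFourierCoeff_of_continuousOn_stLift (hS.continuousOn n) k).norm.pow 2))

/-- **Partial dissipation is bounded by the dissipation** of a Galerkin approximation:
`∫ₛᵗ 4π² ∑_{k∈S} |k|² ‖Û_n(τ,k)‖² dτ ≤ (∫⁻_{(s,t)} ‖∇U n‖²).toReal` for `0 ≤ s ≤ t`. [folklore] -/
theorem IsHopfGalerkinScheme.intervalIntegral_dissipation_sum_le
    (hS : IsHopfGalerkinScheme ν f u₀ N F U) (n : ℕ) (S : Finset (d → ℤ)) {s t : ℝ} (hs : 0 ≤ s)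
    (hst : s ≤ t) :
    ∫ τ in s..t, (4 * Real.pi ^ 2 * ∑ k ∈ S, FunctionSpaces.Torus.freqNormSq k *
        ‖mFourierCoeff (FunctionSpaces.EuclideanSpace.complexify ∘ U n τ) k‖ ^ 2) ≤
      (∫⁻ τ in Ioo s t, FunctionSpaces.Torus.eGradNormSq (U n τ)).toReal := by
  rw [Torus.intervalIntegral_eq_toReal_lintegral hst
    ((hS.continuousOn_dissipation_sum n S).mono fun τ hτ => mem_Ici.2 (hs.trans hτ.1))
    (fun τ _ => mul_nonneg (by positivity) (Finset.sum_nonneg fun k _ =>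
      mul_nonneg (FunctionSpaces.Torus.freqNormSq_nonneg k) (sq_nonneg _)))]
  have hfin : ∫⁻ τ in Ioo s t, FunctionSpaces.Torus.eGradNormSq (U n τ) ≠ ⊤ :=
    (lt_of_le_of_lt (lintegral_mono_set (Ioo_subset_Ioo_left hs))
      (hS.lintegral_eGradNormSq_lt_top n t)).ne
  exact ENNReal.toReal_mono hfin (lintegral_mono fun τ =>
    Torus.ofReal_dissipation_sum_le_eGradNormSq (U n τ) S)

/-- **The partial dissipation integrals converge** as `n → ∞`, for every finite set of modes
and `0 ≤ s ≤ t ≤ T` (dominated convergence: the integrands converge for every `τ` and are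
bounded by `4π² ∑_{k∈S} |k|² · Y`). [folklore] -/
theorem IsHopfGalerkinScheme.tendsto_intervalIntegral_dissipation_sum
    (hS : IsHopfGalerkinScheme ν f u₀ N F U) (hν : 0 ≤ ν) (hu₀ : MemLp u₀ 2 volume)
    (hfm : AEStronglyMeasurable (FunctionSpaces.Torus.stLift f) (volume.restrict (Ioi 0 ×ˢ univ)))
    (hf₂ : ∀ T, 0 < T → ∫⁻ t in Ioo 0 T, ∫⁻ x, ‖f t x‖ₑ ^ 2 < ⊤)
    (hc : ∀ t, 0 ≤ t → ∀ k, Tendsto (fun n => mFourierCoeff (FunctionSpaces.EuclideanSpace.complexify ∘ U n t) k)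
      atTop (𝓝 (mFourierCoeff (FunctionSpaces.EuclideanSpace.complexify ∘ u t) k))) {T : ℝ} (hT : 0 < T)
    (S : Finset (d → ℤ)) {s t : ℝ} (hs : 0 ≤ s) (hst : s ≤ t) (htT : t ≤ T) :
    Tendsto (fun n => ∫ τ in s..t, (4 * Real.pi ^ 2 * ∑ k ∈ S, FunctionSpaces.Torus.freqNormSq k *
        ‖mFourierCoeff (FunctionSpaces.EuclideanSpace.complexify ∘ U n τ) k‖ ^ 2)) atTop
      (𝓝 (∫ τ in s..t, (4 * Real.pi ^ 2 * ∑ k ∈ S, FunctionSpaces.Torus.freqNormSq k *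
        ‖mFourierCoeff (FunctionSpaces.EuclideanSpace.complexify ∘ u τ) k‖ ^ 2))) := by
  obtain ⟨A, hA, hFA⟩ := hS.exists_force_bound hfm hf₂ hT
  obtain ⟨Y, hYdef⟩ : ∃ Y : ℝ, Y = 2 * (∫ x, ‖u₀ x‖ ^ 2) + 4 * T * A.toReal := ⟨_, rfl⟩
  have hYn : ∀ n, ∀ τ ∈ Icc 0 T, ∫ x, ‖U n τ x‖ ^ 2 ≤ Y := fun n τ hτ =>
    (hS.integral_norm_sq_le hν hT hA n (hFA n) hτ).trans (by
      have := hS.integral_norm_sq_zero_le hu₀ n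
      rw [hYdef]; linarith)
  refine intervalIntegral.tendsto_integral_filter_of_dominated_convergence
    (fun _ => 4 * Real.pi ^ 2 * ∑ k ∈ S, FunctionSpaces.Torus.freqNormSq k * Y) ?_ ?_ intervalIntegrable_const ?_
  · refine Eventually.of_forall fun n => ?_
    rw [uIoc_of_le hst]
    exact ((hS.continuousOn_dissipation_sum n S).mono
      fun τ hτ => mem_Ici.2 (hs.trans hτ.1.le)).aestronglyMeasurable measurableSet_Ioc
  · refine Eventually.of_forall fun n => ae_of_all _ fun τ hτ => ?_
    rw [uIoc_of_le hst] at hτ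
    have hτ' : τ ∈ Icc 0 T := ⟨hs.trans hτ.1.le, hτ.2.trans htT⟩
    have hnn : 0 ≤ 4 * Real.pi ^ 2 * ∑ k ∈ S, FunctionSpaces.Torus.freqNormSq k *
        ‖mFourierCoeff (FunctionSpaces.EuclideanSpace.complexify ∘ U n τ) k‖ ^ 2 :=
      mul_nonneg (by positivity) (Finset.sum_nonneg fun k _ =>
        mul_nonneg (FunctionSpaces.Torus.freqNormSq_nonneg k) (sq_nonneg _))
    rw [Real.norm_eq_abs, abs_of_nonneg hnn]
    refine mul_le_mul_of_nonneg_left (Finset.sum_le_sum fun k _ => ?_) (by positivity)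
    exact mul_le_mul_of_nonneg_left ((hS.norm_mFourierCoeff_sq_le n hτ'.1 k).trans (hYn n τ hτ'))
      (FunctionSpaces.Torus.freqNormSq_nonneg k)
  · refine ae_of_all _ fun τ hτ => ?_
    rw [uIoc_of_le hst] at hτ
    have hτ0 : 0 ≤ τ := hs.trans hτ.1.le
    exact (tendsto_finsetSum _ fun k _ => ((hc τ hτ0 k).norm.pow 2).const_mul _).const_mul _

/-- **The forcing work over `[s, t]` converges**: `∫ₛᵗ∫⟪F n, U n⟫ → ∫ₛᵗ∫⟪f, u⟫` for
`0 ≤ s ≤ t ≤ T` (from the `L¹(0,T)` convergence `tendsto_lintegral_work_sub`). [cite: RobinsonRodrigoSadowski2016, Thm. 4.4 Step 4] -/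
theorem IsHopfGalerkinScheme.tendsto_work (hS : IsHopfGalerkinScheme ν f u₀ N F U)
    (hν : 0 < ν) (hu₀ : MemLp u₀ 2 volume)
    (hfm : AEStronglyMeasurable (FunctionSpaces.Torus.stLift f) (volume.restrict (Ioi 0 ×ˢ univ)))
    (hf₂ : ∀ T, 0 < T → ∫⁻ t in Ioo 0 T, ∫⁻ x, ‖f t x‖ₑ ^ 2 < ⊤)
    (hum : AEStronglyMeasurable (FunctionSpaces.Torus.stLift u) (volume.restrict (Ioi 0 ×ˢ univ)))
    (hu : ∀ t, 0 ≤ t → MemLp (u t) 2 volume)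
    (hc : ∀ t, 0 ≤ t → ∀ k, Tendsto (fun n => mFourierCoeff (FunctionSpaces.EuclideanSpace.complexify ∘ U n t) k)
      atTop (𝓝 (mFourierCoeff (FunctionSpaces.EuclideanSpace.complexify ∘ u t) k))) {T : ℝ} (hT : 0 < T)
    {s t : ℝ} (hs : 0 ≤ s) (hst : s ≤ t) (htT : t ≤ T) :
    Tendsto (fun n => ∫ τ in s..t, ∫ x, ⟪F n τ x, U n τ x⟫) atTop
      (𝓝 (∫ τ in s..t, ∫ x, ⟪f τ x, u τ x⟫)) := by
  have hL1 := hS.tendsto_lintegral_work_sub hν hu₀ hfm hf₂ hum hu hc hT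
  have hint : ∀ n, Integrable (fun τ => ∫ x, ⟪F n τ x, U n τ x⟫) (volume.restrict (Ioo 0 T)) := by
    intro n
    have hcont : ContinuousOn (fun τ => ∫ x, ⟪F n τ x, U n τ x⟫) (Icc 0 T) :=
      (FunctionSpaces.Torus.continuousOn_integral_inner_of_continuousOn_stLift (hS.continuousOn_force n)
        (hS.continuousOn n)).mono fun τ hτ => mem_Ici.2 hτ.1
    exact (hcont.integrableOn_Icc (μ := volume)).mono_set Ioo_subset_Icc_self
  have hconv := tendsto_setIntegral_of_L1 (μ := volume.restrict (Ioo 0 T))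
    (fun τ => ∫ x, ⟪f τ x, u τ x⟫) (Torus.aestronglyMeasurable_integral_inner hfm hum T)
    (F := fun n τ => ∫ x, ⟪F n τ x, U n τ x⟫) (Eventually.of_forall hint) hL1 (Ioo s t)
  have hset : ∀ g : ℝ → ℝ, ∫ τ in Ioo s t, g τ ∂(volume.restrict (Ioo 0 T)) = ∫ τ in s..t, g τ := by
    intro g
    rw [Measure.restrict_restrict measurableSet_Ioo, Set.inter_eq_left.2 (Ioo_subset_Ioo hs htT),
      intervalIntegral.integral_of_le hst, integral_Ioc_eq_integral_Ioo]
  rw [hset] at hconv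
  refine hconv.congr fun n => ?_
  exact hset _

/-- **The energy inequality of the limit from every time of strong convergence**
(Robinson–Rodrigo–Sadowski 2016, Thm. 4.6 via Lemma 4.5 and (4.17)–(4.19); Constantin–Foias
1988, (8.21) and p. 47; Hopf 1951, §4, (4.6)). Let `ν > 0` and let the approximations converge
coefficientwise at every time to `u` (`hc`); if at the time `s ∈ [0, T]` moreover
`U n s → u s` strongly in `L²`, then for every `t ∈ [s, T]`
`½‖u t‖² + ν ∫ₛᵗ ‖∇u‖² ≤ ½‖u s‖² + ∫ₛᵗ ∫ ⟪f, u⟫`.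
Proof: for every finite set of modes, `½ ∑ ‖Û_n(t,k)‖² + ν ∫ₛᵗ 4π² ∑ |k|² ‖Û_n(τ,k)‖²` is at most
the right-hand side of the exact energy identity of `U n`; let `n → ∞` (finite sums; dominated
convergence in `τ`; strong convergence at `s`; `tendsto_work`), then exhaust the modes (Parseval
at time `t`, monotone convergence in `τ`). [cite: RobinsonRodrigoSadowski2016, Thm. 4.6] -/
theorem IsHopfGalerkinScheme.energy_ineq_limit_of_tendsto (hS : IsHopfGalerkinScheme ν f u₀ N F U)
    (hν : 0 < ν) (hu₀ : MemLp u₀ 2 volume)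
    (hfm : AEStronglyMeasurable (FunctionSpaces.Torus.stLift f) (volume.restrict (Ioi 0 ×ˢ univ)))
    (hf₂ : ∀ T, 0 < T → ∫⁻ t in Ioo 0 T, ∫⁻ x, ‖f t x‖ₑ ^ 2 < ⊤)
    (hum : AEStronglyMeasurable (FunctionSpaces.Torus.stLift u) (volume.restrict (Ioi 0 ×ˢ univ)))
    (hu : ∀ t, 0 ≤ t → MemLp (u t) 2 volume)
    (hc : ∀ t, 0 ≤ t → ∀ k, Tendsto (fun n => mFourierCoeff (FunctionSpaces.EuclideanSpace.complexify ∘ U n t) k)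
      atTop (𝓝 (mFourierCoeff (FunctionSpaces.EuclideanSpace.complexify ∘ u t) k))) {T : ℝ} (hT : 0 < T)
    {s : ℝ} (hs : 0 ≤ s)
    (hsconv : Tendsto (fun n => eLpNorm (U n s - u s) 2 volume) atTop (𝓝 0)) {t : ℝ}
    (ht : t ∈ Icc s T) :
    FunctionSpaces.Torus.kineticEnergy (u t) + ν * (∫⁻ τ in Ioo s t, FunctionSpaces.Torus.eGradNormSq (u τ)).toReal ≤
      FunctionSpaces.Torus.kineticEnergy (u s) + ∫ τ in s..t, ∫ x, ⟪f τ x, u τ x⟫ := by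
  have ht0 : 0 ≤ t := hs.trans ht.1
  -- right-hand sides converge
  have hE : Tendsto (fun n => FunctionSpaces.Torus.kineticEnergy (U n s)) atTop (𝓝 (FunctionSpaces.Torus.kineticEnergy (u s))) :=
    (Torus.tendsto_integral_norm_sq_of_tendsto_eLpNorm_sub (fun n => hS.memLp_slice n hs)
      (hu s hs) hsconv).const_mul 2⁻¹
  have hR := hE.add (hS.tendsto_work hν hu₀ hfm hf₂ hum hu hc hT hs ht.1 ht.2)
  -- the truncated inequality for the approximations
  have hineq : ∀ (M n : ℕ),
      2⁻¹ * (∑ k ∈ FunctionSpaces.Torus.freqBall M, ‖mFourierCoeff (FunctionSpaces.EuclideanSpace.complexify ∘ U n t) k‖ ^ 2) +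
        ν * ∫ τ in s..t, (4 * Real.pi ^ 2 * ∑ k ∈ FunctionSpaces.Torus.freqBall M, FunctionSpaces.Torus.freqNormSq k *
          ‖mFourierCoeff (FunctionSpaces.EuclideanSpace.complexify ∘ U n τ) k‖ ^ 2) ≤
      FunctionSpaces.Torus.kineticEnergy (U n s) + ∫ τ in s..t, ∫ x, ⟪F n τ x, U n τ x⟫ := by
    intro M n
    have h1 := Torus.sum_norm_sq_mFourierCoeff_le_integral (hS.memLp_slice n ht0) (FunctionSpaces.Torus.freqBall M)
    have h2 := hS.intervalIntegral_dissipation_sum_le n (FunctionSpaces.Torus.freqBall M) hs ht.1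
    have h3 := hS.energy_eq n s t hs ht.1
    unfold FunctionSpaces.Torus.kineticEnergy at h3 ⊢
    have h2' := mul_le_mul_of_nonneg_left h2 hν.le
    nlinarith
  -- `n → ∞` for each `M`
  have hlimM : ∀ M : ℕ,
      2⁻¹ * (∑ k ∈ FunctionSpaces.Torus.freqBall M, ‖mFourierCoeff (FunctionSpaces.EuclideanSpace.complexify ∘ u t) k‖ ^ 2) +
        ν * ∫ τ in s..t, (4 * Real.pi ^ 2 * ∑ k ∈ FunctionSpaces.Torus.freqBall M, FunctionSpaces.Torus.freqNormSq k *
          ‖mFourierCoeff (FunctionSpaces.EuclideanSpace.complexify ∘ u τ) k‖ ^ 2) ≤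
      FunctionSpaces.Torus.kineticEnergy (u s) + ∫ τ in s..t, ∫ x, ⟪f τ x, u τ x⟫ := by
    intro M
    refine le_of_tendsto_of_tendsto' (Tendsto.add ?_ ?_) hR (hineq M)
    · exact (tendsto_finsetSum _ fun k _ => (hc t ht0 k).norm.pow 2).const_mul _
    · exact (hS.tendsto_intervalIntegral_dissipation_sum hν.le hu₀ hfm hf₂ hc hT
        (FunctionSpaces.Torus.freqBall M) hs ht.1 ht.2).const_mul _
  -- `M → ∞`
  have hA : Tendsto (fun M : ℕ => 2⁻¹ * ∑ k ∈ FunctionSpaces.Torus.freqBall M,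
      ‖mFourierCoeff (FunctionSpaces.EuclideanSpace.complexify ∘ u t) k‖ ^ 2) atTop
      (𝓝 (FunctionSpaces.Torus.kineticEnergy (u t))) :=
    ((FunctionSpaces.Torus.hasSum_sq_norm_mFourierCoeff_complexify (hu t ht0)).comp
      FunctionSpaces.Torus.tendsto_freqBall_atTop).const_mul _
  have hB : Tendsto (fun M : ℕ => ν * ∫ τ in s..t, (4 * Real.pi ^ 2 *
      ∑ k ∈ FunctionSpaces.Torus.freqBall M, FunctionSpaces.Torus.freqNormSq k *
        ‖mFourierCoeff (FunctionSpaces.EuclideanSpace.complexify ∘ u τ) k‖ ^ 2)) atTop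
      (𝓝 (ν * (∫⁻ τ in Ioo s t, FunctionSpaces.Torus.eGradNormSq (u τ)).toReal)) := by
    refine Tendsto.const_mul ν ?_
    -- continuity of the limit integrands, conversion to `lintegral`s
    have hcont : ∀ M : ℕ, ContinuousOn (fun τ => 4 * Real.pi ^ 2 * ∑ k ∈ FunctionSpaces.Torus.freqBall M,
        FunctionSpaces.Torus.freqNormSq k * ‖mFourierCoeff (FunctionSpaces.EuclideanSpace.complexify ∘ u τ) k‖ ^ 2) (Icc s t) :=
      fun M => (continuousOn_const.mul (continuousOn_finsetSum _ fun k _ => continuousOn_const.mul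
        ((hS.continuousOn_mFourierCoeff_limit hν.le hu₀ hfm hf₂ hc k).norm.pow 2))).mono
          fun τ hτ => mem_Ici.2 (hs.trans hτ.1)
    have heq : ∀ M : ℕ, ∫ τ in s..t, (4 * Real.pi ^ 2 * ∑ k ∈ FunctionSpaces.Torus.freqBall M,
        FunctionSpaces.Torus.freqNormSq k * ‖mFourierCoeff (FunctionSpaces.EuclideanSpace.complexify ∘ u τ) k‖ ^ 2) =
        (∫⁻ τ in Ioo s t, ∑ k ∈ FunctionSpaces.Torus.freqBall M, ENNReal.ofReal (4 * Real.pi ^ 2) *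
          (ENNReal.ofReal (FunctionSpaces.Torus.freqNormSq k) *
            ‖mFourierCoeff (FunctionSpaces.EuclideanSpace.complexify ∘ u τ) k‖ₑ ^ 2)).toReal := by
      intro M
      rw [Torus.intervalIntegral_eq_toReal_lintegral ht.1 (hcont M) (fun τ _ =>
        mul_nonneg (by positivity) (Finset.sum_nonneg fun k _ =>
          mul_nonneg (FunctionSpaces.Torus.freqNormSq_nonneg k) (sq_nonneg _)))]
      congr 1
      refine lintegral_congr fun τ => ?_
      exact Torus.ofReal_dissipation_sum_eq _ _
    simp_rw [heq]
    have hfin : ∫⁻ τ in Ioo s t, FunctionSpaces.Torus.eGradNormSq (u τ) ≠ ⊤ :=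
      (lt_of_le_of_lt (lintegral_mono_set (Ioo_subset_Ioo hs ht.2))
        (hS.lintegral_eGradNormSq_limit_lt_top hν hu₀ hfm hf₂ hc hT)).ne
    refine (ENNReal.tendsto_toReal hfin).comp ?_
    -- monotone convergence in `τ`
    refine lintegral_tendsto_of_tendsto_of_monotone (fun M => ?_) (ae_of_all _ fun τ => ?_)
      (ae_of_all _ fun τ => ?_)
    · refine Finset.aemeasurable_fun_sum _ fun k _ => ?_
      refine (((AEStronglyMeasurable.enorm ?_).pow_const 2).const_mul _).const_mul _
      exact (FunctionSpaces.Torus.aestronglyMeasurable_mFourierCoeff_stSlice hum T k).mono_measure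
        (Measure.restrict_mono (Ioo_subset_Ioo hs ht.2) le_rfl)
    · intro M M' hMM'
      exact Finset.sum_le_sum_of_subset (FunctionSpaces.Torus.freqBall_mono hMM')
    · have h := FunctionSpaces.Torus.eGradNormSq_eq_tsum (u τ)
      rw [← ENNReal.tsum_mul_left] at h
      rw [h]
      exact ENNReal.summable.hasSum.comp FunctionSpaces.Torus.tendsto_freqBall_atTop
  exact le_of_tendsto' (hA.add hB) hlimM

/-- **Energy inequality of the limit from time `0`, for every `t`** (Robinson–Rodrigo–Sadowski
2016, (4.17); Hopf 1951, §4): `½‖u t‖² + ν ∫₀ᵗ ‖∇u‖² ≤ ½‖u₀‖² + ∫₀ᵗ ∫ ⟪f, u⟫` for `t ∈ [0, T]`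
(`U n 0 → u₀ = u 0` strongly, `tendsto_initial`). [cite: RobinsonRodrigoSadowski2016, Thm. 4.4 Step 4 (4.17)] -/
theorem IsHopfGalerkinScheme.energy_ineq_zero_limit (hS : IsHopfGalerkinScheme ν f u₀ N F U)
    (hν : 0 < ν) (hu₀ : MemLp u₀ 2 volume) (hdiv : FunctionSpaces.Torus.IsWeaklyDivFree u₀)
    (hfm : AEStronglyMeasurable (FunctionSpaces.Torus.stLift f) (volume.restrict (Ioi 0 ×ˢ univ)))
    (hf₂ : ∀ T, 0 < T → ∫⁻ t in Ioo 0 T, ∫⁻ x, ‖f t x‖ₑ ^ 2 < ⊤)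
    (hum : AEStronglyMeasurable (FunctionSpaces.Torus.stLift u) (volume.restrict (Ioi 0 ×ˢ univ)))
    (hu : ∀ t, 0 ≤ t → MemLp (u t) 2 volume)
    (hc : ∀ t, 0 ≤ t → ∀ k, Tendsto (fun n => mFourierCoeff (FunctionSpaces.EuclideanSpace.complexify ∘ U n t) k)
      atTop (𝓝 (mFourierCoeff (FunctionSpaces.EuclideanSpace.complexify ∘ u t) k))) {T : ℝ} (hT : 0 < T)
    {t : ℝ} (ht : t ∈ Icc 0 T) :
    FunctionSpaces.Torus.kineticEnergy (u t) + ν * (∫⁻ τ in Ioo 0 t, FunctionSpaces.Torus.eGradNormSq (u τ)).toReal ≤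
      FunctionSpaces.Torus.kineticEnergy u₀ + ∫ τ in (0 : ℝ)..t, ∫ x, ⟪f τ x, u τ x⟫ := by
  have hsconv : Tendsto (fun n => eLpNorm (U n 0 - u 0) 2 volume) atTop (𝓝 0) := by
    refine hS.tendsto_initial.congr fun n => eLpNorm_congr_ae ?_
    filter_upwards [hS.limit_zero_ae_eq hu₀ hdiv hu hc] with x hx
    simp [hx]
  rw [← hS.kineticEnergy_limit_zero hu₀ hdiv hu hc]
  exact hS.energy_ineq_limit_of_tendsto hν hu₀ hfm hf₂ hum hu hc hT le_rfl hsconv ht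

/-- **Energy inequality of the limit from almost every time** (the *strong energy inequality*;
Robinson–Rodrigo–Sadowski 2016, Thm. 4.6, after Ladyzhenskaya 1969; Constantin–Foias 1988,
Theorem (Leray), p. 47): for a.e. `s ∈ (0, T)` and every `t ∈ [s, T]`,
`½‖u t‖² + ν ∫ₛᵗ ‖∇u‖² ≤ ½‖u s‖² + ∫ₛᵗ ∫ ⟪f, u⟫`. Proof: by `tendsto_lintegral_enorm_sub_sq`,
`∫₀ᵀ ‖U n s - u s‖²_{L²} ds → 0`, so along a fast subsequence `U n s → u s` in `L²` for a.e.
`s`; apply `energy_ineq_limit_of_tendsto` to the reindexed scheme. [cite: RobinsonRodrigoSadowski2016, Thm. 4.6] -/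
theorem IsHopfGalerkinScheme.energy_ineq_ae_limit (hS : IsHopfGalerkinScheme ν f u₀ N F U)
    (hν : 0 < ν) (hu₀ : MemLp u₀ 2 volume)
    (hfm : AEStronglyMeasurable (FunctionSpaces.Torus.stLift f) (volume.restrict (Ioi 0 ×ˢ univ)))
    (hf₂ : ∀ T, 0 < T → ∫⁻ t in Ioo 0 T, ∫⁻ x, ‖f t x‖ₑ ^ 2 < ⊤)
    (hum : AEStronglyMeasurable (FunctionSpaces.Torus.stLift u) (volume.restrict (Ioi 0 ×ˢ univ)))
    (hu : ∀ t, 0 ≤ t → MemLp (u t) 2 volume)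
    (hc : ∀ t, 0 ≤ t → ∀ k, Tendsto (fun n => mFourierCoeff (FunctionSpaces.EuclideanSpace.complexify ∘ U n t) k)
      atTop (𝓝 (mFourierCoeff (FunctionSpaces.EuclideanSpace.complexify ∘ u t) k))) {T : ℝ} (hT : 0 < T) :
    ∀ᵐ s ∂(volume.restrict (Ioo 0 T)), ∀ t ∈ Icc s T,
      FunctionSpaces.Torus.kineticEnergy (u t) + ν * (∫⁻ τ in Ioo s t, FunctionSpaces.Torus.eGradNormSq (u τ)).toReal ≤
        FunctionSpaces.Torus.kineticEnergy (u s) + ∫ τ in s..t, ∫ x, ⟪f τ x, u τ x⟫ := by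
  have hZ := hS.tendsto_lintegral_enorm_sub_sq hν hu₀ hfm hf₂ hum hu hc hT
  -- a fast subsequence
  have hev : ∀ j : ℕ, ∃ M, ∀ n ≥ M,
      ∫⁻ τ in Ioo 0 T, ∫⁻ x, ‖U n τ x - u τ x‖ₑ ^ 2 ≤ (2⁻¹ : ℝ≥0∞) ^ j := fun j =>
    eventually_atTop.1 (ENNReal.tendsto_nhds_zero.1 hZ _ (ENNReal.pow_pos (by norm_num) j))
  obtain ⟨φ, hφ, hφb⟩ := extraction_forall_of_eventually' hev
  have hGm : ∀ j, AEMeasurable (fun τ => ∫⁻ x, ‖U (φ j) τ x - u τ x‖ₑ ^ 2)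
      (volume.restrict (Ioo 0 T)) := fun j =>
    Torus.aemeasurable_lintegral_enorm_sub_sq (hS.aestronglyMeasurable_stLift (φ j)) hum T
  have htsum : ∫⁻ τ in Ioo 0 T, ∑' j, ∫⁻ x, ‖U (φ j) τ x - u τ x‖ₑ ^ 2 ≠ ⊤ := by
    rw [lintegral_tsum hGm]
    refine ne_top_of_le_ne_top ?_ (ENNReal.tsum_le_tsum hφb)
    rw [ENNReal.tsum_geometric, ENNReal.one_sub_inv_two, inv_inv]
    exact ENNReal.ofNat_ne_top
  have hae : ∀ᵐ τ ∂(volume.restrict (Ioo 0 T)),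
      Tendsto (fun j => ∫⁻ x, ‖U (φ j) τ x - u τ x‖ₑ ^ 2) atTop (𝓝 0) := by
    filter_upwards [ae_lt_top' (AEMeasurable.tsum hGm) htsum] with τ hτ
    exact ENNReal.tendsto_atTop_zero_of_tsum_ne_top hτ.ne
  -- the reindexed scheme
  have hS' := hS.comp_strictMono hφ
  have hc' : ∀ t, 0 ≤ t → ∀ k, Tendsto
      (fun j => mFourierCoeff (FunctionSpaces.EuclideanSpace.complexify ∘ (U ∘ φ) j t) k) atTop
      (𝓝 (mFourierCoeff (FunctionSpaces.EuclideanSpace.complexify ∘ u t) k)) := fun t ht k =>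
    (hc t ht k).comp hφ.tendsto_atTop
  filter_upwards [hae, ae_restrict_mem measurableSet_Ioo] with s hs hsI t ht
  have hsconv : Tendsto (fun j => eLpNorm ((U ∘ φ) j s - u s) 2 volume) atTop (𝓝 0) := by
    have h := ((ENNReal.continuous_rpow_const (y := 1 / 2)).tendsto 0).comp hs
    rw [ENNReal.zero_rpow_of_pos (by norm_num)] at h
    refine h.congr fun j => ?_
    rw [Function.comp_apply, Torus.eLpNorm_two_eq_rpow]
    rfl
  exact hS'.energy_ineq_limit_of_tendsto hν hu₀ hfm hf₂ hum hu hc' hT hsI.1.le hsconv ht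

end EnergyIneq

/-! ## Weak `L²` continuity in time -/

section WeakContinuity

omit [Fintype d] [DecidableEq d] in
/-- Young's inequality `ab ≤ (λ/2) a² + (2λ)⁻¹ b²` (`λ > 0`). [folklore] -/
theorem Torus.mul_le_young (a b : ℝ) {lam : ℝ} (hlam : 0 < lam) :
    a * b ≤ lam / 2 * a ^ 2 + (2 * lam)⁻¹ * b ^ 2 := by
  have key : lam / 2 * a ^ 2 + (2 * lam)⁻¹ * b ^ 2 - a * b = (lam * a - b) ^ 2 / (2 * lam) := by
    field_simp
    ring
  have hnn : 0 ≤ (lam * a - b) ^ 2 / (2 * lam) := by positivity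
  linarith

/-- **Weak `L²` continuity of the limit** (Robinson–Rodrigo–Sadowski 2016, Thm. 4.4 Step 3
with Ex. 4.3 and Thm. 3.8; Hopf 1951, §4): `t ↦ ∫ ⟪u t, w⟫` is continuous on `[0, ∞)` for every
`w ∈ L²(T^d)`. Proof: `∫ ⟪u t, w⟫ = ∑ₖ Re ⟪û(t,k), ŵ(k)⟫`; the partial sums over the balls
`|k| ≤ M` are continuous (`continuousOn_mFourierCoeff_limit`) and converge uniformly on `[0, T]`
because `|∑_{|k|>M} Re ⟪û, ŵ⟫| ≤ (λ/2) ∑ ‖û(t,k)‖² + (2λ)⁻¹ ∑_{|k|>M} ‖ŵ(k)‖²` with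
`∑ ‖û(t,k)‖² ≤ 2‖u₀‖² + 4T·A` uniformly in `t`. [cite: RobinsonRodrigoSadowski2016, Thm. 4.4 Step 3, Ex. 4.3] -/
theorem IsHopfGalerkinScheme.continuousOn_integral_inner_limit
    (hS : IsHopfGalerkinScheme ν f u₀ N F U) (hν : 0 ≤ ν) (hu₀ : MemLp u₀ 2 volume)
    (hfm : AEStronglyMeasurable (FunctionSpaces.Torus.stLift f) (volume.restrict (Ioi 0 ×ˢ univ)))
    (hf₂ : ∀ T, 0 < T → ∫⁻ t in Ioo 0 T, ∫⁻ x, ‖f t x‖ₑ ^ 2 < ⊤)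
    (hu : ∀ t, 0 ≤ t → MemLp (u t) 2 volume)
    (hc : ∀ t, 0 ≤ t → ∀ k, Tendsto (fun n => mFourierCoeff (FunctionSpaces.EuclideanSpace.complexify ∘ U n t) k)
      atTop (𝓝 (mFourierCoeff (FunctionSpaces.EuclideanSpace.complexify ∘ u t) k)))
    {w : UnitAddTorus d → EuclideanSpace ℝ d} (hw : MemLp w 2 volume) :
    ContinuousOn (fun t => ∫ x, ⟪u t x, w x⟫) (Ici 0) := by
  -- the coefficient families
  obtain ⟨a, ha⟩ : ∃ a : ℝ → (d → ℤ) → ℝ, a = fun t k =>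
      (inner ℂ (mFourierCoeff (FunctionSpaces.EuclideanSpace.complexify ∘ u t) k)
        (mFourierCoeff (FunctionSpaces.EuclideanSpace.complexify ∘ w) k)).re := ⟨_, rfl⟩
  obtain ⟨bw, hbw⟩ : ∃ bw : (d → ℤ) → ℝ, bw = fun k =>
      ‖mFourierCoeff (FunctionSpaces.EuclideanSpace.complexify ∘ w) k‖ ^ 2 := ⟨_, rfl⟩
  have hsum : ∀ t, 0 ≤ t → HasSum (a t) (∫ x, ⟪u t x, w x⟫) := fun t ht => by
    rw [ha]; exact FunctionSpaces.Torus.hasSum_re_inner_mFourierCoeff_complexify (hu t ht) hw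
  have hbw_sum : Summable bw := by
    rw [hbw]; exact (FunctionSpaces.Torus.hasSum_sq_norm_mFourierCoeff_complexify hw).summable
  have hbw0 : ∀ k, 0 ≤ bw k := fun k => by rw [hbw]; exact sq_nonneg _
  -- tails of `w`
  have htail : Tendsto (fun M : ℕ => ∑' k : {k // k ∉ FunctionSpaces.Torus.freqBall (d := d) M}, bw k) atTop
      (𝓝 0) :=
    (tendsto_tsum_compl_atTop_zero bw).comp FunctionSpaces.Torus.tendsto_freqBall_atTop
  -- continuity of the partial sums
  have hPcont : ∀ M : ℕ, ContinuousOn (fun t => ∑ k ∈ FunctionSpaces.Torus.freqBall M, a t k) (Ici 0) := by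
    intro M
    rw [ha]
    refine continuousOn_finsetSum _ fun k _ => ?_
    exact Complex.continuous_re.comp_continuousOn
      ((hS.continuousOn_mFourierCoeff_limit hν hu₀ hfm hf₂ hc k).inner continuousOn_const)
  -- continuity on every `[0, T]`
  have hT : ∀ T : ℝ, 0 < T → ContinuousOn (fun t => ∫ x, ⟪u t x, w x⟫) (Icc 0 T) := by
    intro T hT
    obtain ⟨A, hA, hFA⟩ := hS.exists_force_bound hfm hf₂ hT
    obtain ⟨Y, hYdef⟩ : ∃ Y : ℝ, Y = 2 * (∫ x, ‖u₀ x‖ ^ 2) + 4 * T * A.toReal := ⟨_, rfl⟩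
    have hYu : ∀ t ∈ Icc 0 T, ∫ x, ‖u t x‖ ^ 2 ≤ Y := fun t ht => by
      rw [hYdef]; exact hS.integral_norm_sq_limit_le hν hu₀ hu hc hT hA hFA ht
    have hY0 : 0 ≤ Y := le_trans (integral_nonneg fun x => sq_nonneg _) (hYu 0 ⟨le_rfl, hT.le⟩)
    -- the uniform estimate
    have hest : ∀ {lam : ℝ}, 0 < lam → ∀ (M : ℕ), ∀ t ∈ Icc 0 T,
        |(∫ x, ⟪u t x, w x⟫) - ∑ k ∈ FunctionSpaces.Torus.freqBall M, a t k| ≤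
          lam / 2 * Y + (2 * lam)⁻¹ * ∑' k : {k // k ∉ FunctionSpaces.Torus.freqBall (d := d) M}, bw k := by
      intro lam hlam M t ht
      have hat : Summable (a t) := (hsum t ht.1).summable
      obtain ⟨bu, hbu⟩ : ∃ bu : (d → ℤ) → ℝ, bu = fun k =>
          ‖mFourierCoeff (FunctionSpaces.EuclideanSpace.complexify ∘ u t) k‖ ^ 2 := ⟨_, rfl⟩
      have hbu_sum : HasSum bu (∫ x, ‖u t x‖ ^ 2) := by
        rw [hbu]; exact FunctionSpaces.Torus.hasSum_sq_norm_mFourierCoeff_complexify (hu t ht.1)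
      have hsplit := hat.sum_add_tsum_compl (s := FunctionSpaces.Torus.freqBall M)
      rw [(hsum t ht.1).tsum_eq] at hsplit
      have hdiff : (∫ x, ⟪u t x, w x⟫) - ∑ k ∈ FunctionSpaces.Torus.freqBall M, a t k =
          ∑' k : ↥((FunctionSpaces.Torus.freqBall M : Finset (d → ℤ)) : Set (d → ℤ))ᶜ, a t k := by linarith
      rw [hdiff]
      -- termwise Young bound
      obtain ⟨b, hb⟩ : ∃ b : (d → ℤ) → ℝ, b = fun k => lam / 2 * bu k + (2 * lam)⁻¹ * bw k :=
        ⟨_, rfl⟩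
      have hb_sum : Summable b := by
        rw [hb]; exact (hbu_sum.summable.mul_left _).add (hbw_sum.mul_left _)
      have hpt : ∀ k, ‖a t k‖ ≤ b k := by
        intro k
        rw [Real.norm_eq_abs, ha, hb, hbu, hbw]
        refine (Complex.abs_re_le_norm _).trans ((norm_inner_le_norm _ _).trans ?_)
        exact Torus.mul_le_young _ _ hlam
      have h1 : ‖∑' k : ↥((FunctionSpaces.Torus.freqBall M : Finset (d → ℤ)) : Set (d → ℤ))ᶜ, a t k‖ ≤
          ∑' k : ↥((FunctionSpaces.Torus.freqBall M : Finset (d → ℤ)) : Set (d → ℤ))ᶜ, b k :=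
        HasSum.norm_le_of_bounded (hat.subtype _).hasSum (hb_sum.subtype _).hasSum fun k => hpt k
      rw [Real.norm_eq_abs] at h1
      refine h1.trans ?_
      have h2 : ∑' k : ↥((FunctionSpaces.Torus.freqBall M : Finset (d → ℤ)) : Set (d → ℤ))ᶜ, b k =
          lam / 2 * ∑' k : ↥((FunctionSpaces.Torus.freqBall M : Finset (d → ℤ)) : Set (d → ℤ))ᶜ, bu k +
            (2 * lam)⁻¹ * ∑' k : ↥((FunctionSpaces.Torus.freqBall M : Finset (d → ℤ)) : Set (d → ℤ))ᶜ, bw k := by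
        have hs1 : Summable fun k : ↥((FunctionSpaces.Torus.freqBall M : Finset (d → ℤ)) : Set (d → ℤ))ᶜ =>
            lam / 2 * bu k := (hbu_sum.summable.subtype _).mul_left _
        have hs2 : Summable fun k : ↥((FunctionSpaces.Torus.freqBall M : Finset (d → ℤ)) : Set (d → ℤ))ᶜ =>
            (2 * lam)⁻¹ * bw k := (hbw_sum.subtype _).mul_left _
        rw [← tsum_mul_left, ← tsum_mul_left, ← hs1.tsum_add hs2, hb]
      rw [h2]
      have h3 : ∑' k : ↥((FunctionSpaces.Torus.freqBall M : Finset (d → ℤ)) : Set (d → ℤ))ᶜ, bu k ≤ Y := by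
        refine le_trans (Summable.tsum_subtype_le bu _ (fun k => ?_) hbu_sum.summable) ?_
        · rw [hbu]; exact sq_nonneg _
        · rw [hbu_sum.tsum_eq]
          exact hYu t ht
      have h4 : ∑' k : ↥((FunctionSpaces.Torus.freqBall M : Finset (d → ℤ)) : Set (d → ℤ))ᶜ, bw k =
          ∑' k : {k // k ∉ FunctionSpaces.Torus.freqBall (d := d) M}, bw k := rfl
      rw [h4]
      have hl2 : 0 ≤ (2 * lam)⁻¹ := by positivity
      nlinarith [mul_le_mul_of_nonneg_left h3 (show 0 ≤ lam / 2 by positivity)]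
    -- uniform convergence of the continuous partial sums
    have hunif : TendstoUniformlyOn (fun (M : ℕ) t => ∑ k ∈ FunctionSpaces.Torus.freqBall M, a t k)
        (fun t => ∫ x, ⟪u t x, w x⟫) atTop (Icc 0 T) := by
      rw [Metric.tendstoUniformlyOn_iff]
      intro ε hε
      obtain ⟨lam, hlamdef⟩ : ∃ lam : ℝ, lam = ε / (Y + 1) := ⟨_, rfl⟩
      have hlam0 : 0 < lam := by rw [hlamdef]; positivity
      have h1 : lam / 2 * Y < ε / 2 := by
        have hY1 : Y / (Y + 1) < 1 := (div_lt_one (by positivity)).2 (lt_add_one Y)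
        have : lam / 2 * Y = ε / 2 * (Y / (Y + 1)) := by rw [hlamdef]; ring
        rw [this]
        exact mul_lt_of_lt_one_right (by positivity) hY1
      have hM : ∀ᶠ M : ℕ in atTop, ∑' k : {k // k ∉ FunctionSpaces.Torus.freqBall (d := d) M}, bw k < lam * ε :=
        htail.eventually (gt_mem_nhds (by positivity))
      filter_upwards [hM] with M hM' t ht
      rw [Real.dist_eq]
      have h2 : (2 * lam)⁻¹ * ∑' k : {k // k ∉ FunctionSpaces.Torus.freqBall (d := d) M}, bw k < ε / 2 := by
        calc (2 * lam)⁻¹ * ∑' k : {k // k ∉ FunctionSpaces.Torus.freqBall (d := d) M}, bw k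
            < (2 * lam)⁻¹ * (lam * ε) := mul_lt_mul_of_pos_left hM' (by positivity)
          _ = ε / 2 := by field_simp
      exact lt_of_le_of_lt (hest hlam0 M t ht) (by linarith)
    exact hunif.continuousOn (Eventually.of_forall fun M => (hPcont M).mono Icc_subset_Ici_self).frequently
  -- conclusion on `[0, ∞)`
  intro t₀ ht₀
  rw [mem_Ici] at ht₀
  have h := (hT (t₀ + 1) (by linarith)).continuousWithinAt (x := t₀) ⟨ht₀, by linarith⟩
  refine h.mono_of_mem_nhdsWithin ?_
  exact mem_of_superset (inter_mem_nhdsWithin (Ici (0 : ℝ)) (Iio_mem_nhds (by linarith : t₀ < t₀ + 1)))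
    fun x hx => ⟨hx.1, hx.2.le⟩

end WeakContinuity

/-! ## The energy class of the limit -/

section EnergyClass

omit [DecidableEq d] in
/-- The `H¹` norm is dominated by the `L²` norm plus the spectral gradient norm:
`‖complexify ∘ v‖²_{H¹} ≤ ∫⁻ ‖v‖ₑ² + ‖∇v‖²` for `v ∈ L²` (`1 + |k|² ≤ 1 + 4π²|k|²`;
cf. the named fact `Torus.eSobolevNorm_one_sq_eq`, an identity with the factor `(4π²)⁻¹`). [folklore] -/
theorem Torus.eSobolevNorm_one_complexify_sq_le {v : UnitAddTorus d → EuclideanSpace ℝ d}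
    (hv : MemLp v 2 volume) :
    FunctionSpaces.Torus.eSobolevNorm 1 (FunctionSpaces.EuclideanSpace.complexify ∘ v) ^ 2 ≤
      (∫⁻ x, ‖v x‖ₑ ^ 2) + FunctionSpaces.Torus.eGradNormSq v := by
  rw [FunctionSpaces.Torus.eSobolevNorm, ENNReal.rpow_half_sq, ← FunctionSpaces.Torus.tsum_enorm_sq_mFourierCoeff_complexify hv,
    FunctionSpaces.Torus.eGradNormSq_eq_tsum, ← ENNReal.tsum_mul_left, ← ENNReal.tsum_add]
  refine ENNReal.tsum_le_tsum fun k => ?_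
  have hw : FunctionSpaces.Torus.sobolevWeight 1 k ^ 2 = 1 + FunctionSpaces.Torus.freqNormSq k := by
    rw [FunctionSpaces.Torus.sobolevWeight, ← Real.rpow_natCast, ← Real.rpow_mul (by
      have := FunctionSpaces.Torus.freqNormSq_nonneg k; positivity)]
    norm_num
  rw [hw, ENNReal.ofReal_add zero_le_one (FunctionSpaces.Torus.freqNormSq_nonneg k), ENNReal.ofReal_one, add_mul,
    one_mul, ← mul_assoc, ← ENNReal.ofReal_mul (by positivity)]
  refine add_le_add le_rfl (mul_le_mul' (ENNReal.ofReal_le_ofReal ?_) le_rfl)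
  have h1 : (1 : ℝ) ≤ 4 * Real.pi ^ 2 := by nlinarith [Real.pi_gt_three]
  nlinarith [FunctionSpaces.Torus.freqNormSq_nonneg k]

/-- **The limit lies in `L²(0, T; H¹)`** spectrally (the clause `memL2Sobolev` of
`Torus.IsLerayHopfOn`; Robinson–Rodrigo–Sadowski 2016, (4.10)–(4.11); Temam, Ch. III,
Thm. 3.1): a.e. slice is in `H¹` and `∫₀ᵀ ‖u‖²_{H¹} < ∞`, from the uniform `L²` bound and
`lintegral_eGradNormSq_limit_le`. [cite: RobinsonRodrigoSadowski2016, Thm. 4.4 Step 3 (4.10)–(4.11)] -/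
theorem IsHopfGalerkinScheme.memL2Sobolev_limit (hS : IsHopfGalerkinScheme ν f u₀ N F U)
    (hν : 0 < ν) (hu₀ : MemLp u₀ 2 volume)
    (hfm : AEStronglyMeasurable (FunctionSpaces.Torus.stLift f) (volume.restrict (Ioi 0 ×ˢ univ)))
    (hf₂ : ∀ T, 0 < T → ∫⁻ t in Ioo 0 T, ∫⁻ x, ‖f t x‖ₑ ^ 2 < ⊤)
    (hum : AEStronglyMeasurable (FunctionSpaces.Torus.stLift u) (volume.restrict (Ioi 0 ×ˢ univ)))
    (hu : ∀ t, 0 ≤ t → MemLp (u t) 2 volume)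
    (hc : ∀ t, 0 ≤ t → ∀ k, Tendsto (fun n => mFourierCoeff (FunctionSpaces.EuclideanSpace.complexify ∘ U n t) k)
      atTop (𝓝 (mFourierCoeff (FunctionSpaces.EuclideanSpace.complexify ∘ u t) k))) {T : ℝ} (hT : 0 < T) :
    FunctionSpaces.Torus.MemL2Sobolev 0 T 1 (fun t => FunctionSpaces.EuclideanSpace.complexify ∘ u t) := by
  obtain ⟨A, hA, hFA⟩ := hS.exists_force_bound hfm hf₂ hT
  obtain ⟨Y, hYdef⟩ : ∃ Y : ℝ, Y = 2 * (∫ x, ‖u₀ x‖ ^ 2) + 4 * T * A.toReal := ⟨_, rfl⟩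
  have hYu : ∀ t ∈ Icc 0 T, ∫ x, ‖u t x‖ ^ 2 ≤ Y := fun t ht => by
    rw [hYdef]; exact hS.integral_norm_sq_limit_le hν.le hu₀ hu hc hT hA hFA ht
  have hL2 : ∀ t ∈ Ioo 0 T, ∫⁻ x, ‖u t x‖ₑ ^ 2 ≤ ENNReal.ofReal Y := fun t ht => by
    rw [Torus.lintegral_enorm_sq_eq_ofReal (hu t ht.1.le)]
    exact ENNReal.ofReal_le_ofReal (hYu t ⟨ht.1.le, ht.2.le⟩)
  have hGfin := hS.lintegral_eGradNormSq_limit_lt_top hν hu₀ hfm hf₂ hc hT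
  have hGm : AEMeasurable (fun t => FunctionSpaces.Torus.eGradNormSq (u t)) (volume.restrict (Ioo 0 T)) :=
    Torus.aemeasurable_eGradNormSq_of_coeff fun k => FunctionSpaces.Torus.aestronglyMeasurable_mFourierCoeff_stSlice hum T k
  refine ⟨?_, ?_⟩
  · filter_upwards [ae_lt_top' hGm hGfin.ne, ae_restrict_mem measurableSet_Ioo] with t hGt ht
    refine ⟨FunctionSpaces.Torus.integrable_complexify_comp ((hu t ht.1.le).integrable one_le_two), ?_⟩
    have h := Torus.eSobolevNorm_one_complexify_sq_le (hu t ht.1.le)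
    have hfin : (∫⁻ x, ‖u t x‖ₑ ^ 2) + FunctionSpaces.Torus.eGradNormSq (u t) < ⊤ :=
      ENNReal.add_lt_top.2 ⟨lt_of_le_of_lt (hL2 t ht) ENNReal.ofReal_lt_top, hGt⟩
    have h2 : FunctionSpaces.Torus.eSobolevNorm 1 (FunctionSpaces.EuclideanSpace.complexify ∘ u t) ^ 2 < ⊤ := lt_of_le_of_lt h hfin
    by_contra htop
    rw [not_lt, top_le_iff] at htop
    rw [htop, ENNReal.top_pow two_ne_zero] at h2
    exact lt_irrefl _ h2
  · rw [FunctionSpaces.Torus.eL2SobolevNorm]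
    refine ENNReal.rpow_lt_top_of_nonneg (by norm_num) (lt_top_iff_ne_top.1 ?_)
    calc ∫⁻ t in Ioo 0 T, FunctionSpaces.Torus.eSobolevNorm 1 (FunctionSpaces.EuclideanSpace.complexify ∘ u t) ^ 2
        ≤ ∫⁻ t in Ioo 0 T, ((∫⁻ x, ‖u t x‖ₑ ^ 2) + FunctionSpaces.Torus.eGradNormSq (u t)) :=
          setLIntegral_mono' measurableSet_Ioo fun t ht =>
            Torus.eSobolevNorm_one_complexify_sq_le (hu t ht.1.le)
      _ ≤ ∫⁻ t in Ioo 0 T, (ENNReal.ofReal Y + FunctionSpaces.Torus.eGradNormSq (u t)) :=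
          setLIntegral_mono' measurableSet_Ioo fun t ht => add_le_add (hL2 t ht) le_rfl
      _ = (∫⁻ _ in Ioo 0 T, ENNReal.ofReal Y) + ∫⁻ t in Ioo 0 T, FunctionSpaces.Torus.eGradNormSq (u t) :=
          lintegral_add_left' aemeasurable_const _
      _ < ⊤ := by
          rw [setLIntegral_const]
          exact ENNReal.add_lt_top.2 ⟨ENNReal.mul_lt_top ENNReal.ofReal_lt_top measure_Ioo_lt_top,
            hGfin⟩

/-- **`L^∞(0,T; L²)` bound of the limit** (the clause `energy_bound` of `Torus.IsLerayHopfOn`;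
Robinson–Rodrigo–Sadowski 2016, (4.10)). [cite: RobinsonRodrigoSadowski2016, Thm. 4.4 Step 3 (4.10)] -/
theorem IsHopfGalerkinScheme.energy_bound_limit (hS : IsHopfGalerkinScheme ν f u₀ N F U)
    (hν : 0 ≤ ν) (hu₀ : MemLp u₀ 2 volume)
    (hfm : AEStronglyMeasurable (FunctionSpaces.Torus.stLift f) (volume.restrict (Ioi 0 ×ˢ univ)))
    (hf₂ : ∀ T, 0 < T → ∫⁻ t in Ioo 0 T, ∫⁻ x, ‖f t x‖ₑ ^ 2 < ⊤)
    (hu : ∀ t, 0 ≤ t → MemLp (u t) 2 volume)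
    (hc : ∀ t, 0 ≤ t → ∀ k, Tendsto (fun n => mFourierCoeff (FunctionSpaces.EuclideanSpace.complexify ∘ U n t) k)
      atTop (𝓝 (mFourierCoeff (FunctionSpaces.EuclideanSpace.complexify ∘ u t) k))) {T : ℝ} (hT : 0 < T) :
    ∃ C : ℝ≥0, ∀ᵐ t ∂(volume.restrict (Ioo 0 T)), ∫⁻ x, ‖u t x‖ₑ ^ 2 ≤ C := by
  obtain ⟨A, hA, hFA⟩ := hS.exists_force_bound hfm hf₂ hT
  refine ⟨(2 * (∫ x, ‖u₀ x‖ ^ 2) + 4 * T * A.toReal).toNNReal, ?_⟩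
  filter_upwards [ae_restrict_mem measurableSet_Ioo] with t ht
  rw [Torus.lintegral_enorm_sq_eq_ofReal (hu t ht.1.le)]
  exact ENNReal.ofReal_le_ofReal (hS.integral_norm_sq_limit_le hν hu₀ hu hc hT hA hFA ⟨ht.1.le, ht.2.le⟩)

/-- The limit is square integrable on `(0, T) × T^d` (second conjunct of
`Torus.IsWeakNSSolutionForcedOn`). [folklore] -/
theorem IsHopfGalerkinScheme.lintegral_limit_lt_top (hS : IsHopfGalerkinScheme ν f u₀ N F U)
    (hν : 0 ≤ ν) (hu₀ : MemLp u₀ 2 volume)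
    (hfm : AEStronglyMeasurable (FunctionSpaces.Torus.stLift f) (volume.restrict (Ioi 0 ×ˢ univ)))
    (hf₂ : ∀ T, 0 < T → ∫⁻ t in Ioo 0 T, ∫⁻ x, ‖f t x‖ₑ ^ 2 < ⊤)
    (hu : ∀ t, 0 ≤ t → MemLp (u t) 2 volume)
    (hc : ∀ t, 0 ≤ t → ∀ k, Tendsto (fun n => mFourierCoeff (FunctionSpaces.EuclideanSpace.complexify ∘ U n t) k)
      atTop (𝓝 (mFourierCoeff (FunctionSpaces.EuclideanSpace.complexify ∘ u t) k))) {T : ℝ} (hT : 0 < T) :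
    ∫⁻ t in Ioo 0 T, ∫⁻ x, ‖u t x‖ₑ ^ 2 < ⊤ := by
  obtain ⟨C, hC⟩ := hS.energy_bound_limit hν hu₀ hfm hf₂ hu hc hT
  calc ∫⁻ t in Ioo 0 T, ∫⁻ x, ‖u t x‖ₑ ^ 2 ≤ ∫⁻ _ in Ioo 0 T, (C : ℝ≥0∞) := lintegral_mono_ae hC
    _ < ⊤ := by
        rw [setLIntegral_const]
        exact ENNReal.mul_lt_top ENNReal.coe_lt_top measure_Ioo_lt_top

end EnergyClass



end NS

end Literature.Analysis.FluidPDE
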